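import Summits.AtomisticToContinuum.BoseEinsteinCondensation.Theses.BECModePrice
import Summits.AtomisticToContinuum.BoseEinsteinCondensation.Theorems.BECModePriceModePriceHardCoreTowerShadow
import HarnessLib

/-!
# Skeleton v3 (reconstructed by lead c1) — crux `BECModePrice.ModePriceHardCore` (stmt-AtomisticToContinuum-18513),
# line `IdeatorSketchK1` (idea `tower-shadow`)

Everything of the line except ONE stub is landed (p165794, p166332, p166605, p166728, p169080):
`ModePriceHardCore_of : ModePriceHardCore := modePriceHardCore_of_scaleFree stub_scaleFreeModePriceIntegrable`.
The remaining registered stub `stub_scaleFreeModePriceIntegrable` is single-mode softening for all INTEGRABLE repulsive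
finite-range potentials of range `≤ R₀` with range-only constants; it implies BOTH price cruxes of the route
(`modePrice_both_of_scaleFree`), hence is crux-sized (promote-stub standing since lead cycle 1).
-/

noncomputable section

namespace Summit.AtomisticToContinuum.BoseEinsteinCondensation.Cruxes.ModePriceHardCore.TowerShadow

open MeasureTheory Filter
open scoped ENNReal NNReal Topology
open Literature.MathematicalPhysics.QuantumManyBody.BoseGas
open Summit.AtomisticToContinuum.BoseEinsteinCondensation.Theses.BECModePrice

/-- **Stub `stub_scaleFreeModePriceIntegrable` (open-problem calibre).** Single-mode softening for all INTEGRABLE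
repulsive finite-range potentials of range `≤ R₀`, with `(C, ρ₀, N₀)` depending on `R₀` only: for `0 < ρ < ρ₀`,
`N ≥ N₀`, every `p ≠ 0`, every such `v` and every periodic trial state,
`E₀^per(v) + ½|2πp/L|² n_p(Ψ) ≤ ⟨Ψ, H_v Ψ⟩ + Cρ` (Bogoliubov value of the price `0.049·8πρ·a(v) ≤ 1.24 ρ R₀`). -/
theorem stub_scaleFreeModePriceIntegrable :
    ∀ R₀ : ℝ, 0 < R₀ → ∃ C : ℝ, 0 < C ∧ ∃ ρ₀ : ℝ, 0 < ρ₀ ∧ ∀ ρ : ℝ, 0 < ρ → ρ < ρ₀ →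
      ∃ N₀ : ℕ, ∀ N : ℕ, N₀ ≤ N → ∀ p : Fin 3 → ℤ, p ≠ 0 →
        ∀ v : ℝ → ℝ≥0∞, IsRepulsiveFiniteRange v → (∀ r, R₀ < r → v r = 0) →
          (∫⁻ x : Space, v ‖x‖) ≠ ⊤ →
          ∀ Ψ : PeriodicTrialState N (sideLength ρ N),
            periodicGroundStateEnergy v N (sideLength ρ N)
                + 2⁻¹ * fracDispersion 2 (sideLength ρ N) p
                  * cellOccupation N (sideLength ρ N) (planeWaveMode (sideLength ρ N) p) Ψ.ψ
              ≤ periodicEnergy v Ψ + ENNReal.ofReal (C * ρ) := by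
  sorry

/-- **`ModePriceHardCore` from the line `IdeatorSketchK1` / tower shadow** (no `sorry` of its own): scale-free integrable
SMS ⇒ height-uniform tower SMS ⇒ crux (`modePriceHardCore_of_scaleFree`, landed p166605/p166728). -/
theorem ModePriceHardCore_of : ModePriceHardCore :=
  modePriceHardCore_of_scaleFree stub_scaleFreeModePriceIntegrable

end Summit.AtomisticToContinuum.BoseEinsteinCondensation.Cruxes.ModePriceHardCore.TowerShadow

end
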